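import Summits.QuantumFields.YangMills.Theses.UniversalDetector
import Literature.Analysis.FunctionSpaces.GaussianSchwartz

/-!
# Route `UniversalDetector`, support item `DetectorExists` (stmt-QuantumFields-26598) — proof

The explicit detector of LINE 4 (ideator seat ym-idea-8 g2, rung R2a): `v₀(y) = h(y₀)·e^{-‖y‖²}` with `h` a smooth
bump on `ℝ` (centre `2`, radii `1/2 < 1`, so `tsupport h = [1, 3]`), realised as a Schwartz function by
`SchwartzMap.smulLeftCLM` (temperate-growth multiplier `y ↦ h(y₀)`) acting on the real Gaussian Schwartz function
`realGaussianSchwartz`; the two support inclusions for `v₀` and `ϑv₀` follow from `tsupport h ⊆ [1,3]`.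
No summit, leg or spine crux is proved here.
-/

set_option autoImplicit false

namespace Summit.QuantumFields.YangMills.Theorems

open MeasureTheory
open Literature.MathematicalPhysics.QuantumLattice Literature.Analysis.FunctionSpaces

/-- A closed-support helper: if `F y ≠ 0 → y ∈ S` and `S` is closed then `tsupport F ⊆ S`. -/
theorem tsupport_subset_of_closed {X : Type*} [TopologicalSpace X] {F : X → ℝ} {S : Set X}
    (hS : IsClosed S) (h : ∀ y, F y ≠ 0 → y ∈ S) : tsupport F ⊆ S :=
  closure_minimal (fun y hy => h y hy) hS

/-- The support item `DetectorExists` of route `UniversalDetector` (stmt-QuantumFields-26598) holds. -/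
theorem universalDetector_detectorExists :
    Summit.QuantumFields.YangMills.Theses.UniversalDetector.DetectorExists := by
  let b : ContDiffBump (2 : ℝ) := ⟨1 / 2, 1, by norm_num, by norm_num⟩
  have h1 : Function.HasTemperateGrowth (b : ℝ → ℝ) := b.hasCompactSupport.hasTemperateGrowth b.contDiff
  have h2 : Function.HasTemperateGrowth (fun y : EuclideanSpace ℝ (Fin 4) => y 0) :=
    (EuclideanSpace.proj (0 : Fin 4) : EuclideanSpace ℝ (Fin 4) →L[ℝ] ℝ).hasTemperateGrowth
  have hbT : Function.HasTemperateGrowth (fun y : EuclideanSpace ℝ (Fin 4) => b (y 0)) := h1.comp h2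
  have hbsupp : tsupport (b : ℝ → ℝ) ⊆ Set.Icc 1 3 := by
    rw [b.tsupport_eq, Real.closedBall_eq_Icc]
    norm_num
  have hb_of_ne : ∀ t : ℝ, b t ≠ 0 → 1 ≤ t ∧ t ≤ 3 := fun t ht =>
    hbsupp (subset_tsupport _ (Function.mem_support.2 ht))
  have h0c : Continuous fun y : EuclideanSpace ℝ (Fin 4) => y 0 := PiLp.continuous_apply 2 _ 0
  set v₀ : SchwartzMap (EuclideanSpace ℝ (Fin 4)) ℝ :=
    SchwartzMap.smulLeftCLM ℝ (fun y : EuclideanSpace ℝ (Fin 4) => b (y 0))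
      (realGaussianSchwartz (EuclideanSpace ℝ (Fin 4)) 1) with hv₀def
  have hv₀ : ∀ y, v₀ y = b (y 0) * Real.exp (-‖y‖ ^ 2) := by
    intro y
    rw [hv₀def, SchwartzMap.smulLeftCLM_apply_apply hbT, realGaussianSchwartz_apply one_pos, smul_eq_mul,
      neg_one_mul]
  refine ⟨v₀, b, 1, 3, one_pos, b.continuous, fun t => b.nonneg' t, hbsupp, ⟨2, ?_⟩, hv₀, ?_, ?_⟩
  · rw [b.one_of_mem_closedBall (Metric.mem_closedBall_self b.rIn_pos.le)]
    exact one_ne_zero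
  · refine tsupport_subset_of_closed (isClosed_Icc.preimage h0c) (fun y hy => ?_)
    rw [hv₀] at hy
    exact hb_of_ne _ (left_ne_zero_of_mul hy)
  · refine tsupport_subset_of_closed (isClosed_Icc.preimage h0c.neg) (fun y hy => ?_)
    rw [thetaTest_apply, hv₀, timeReflection_apply, if_pos rfl] at hy
    exact hb_of_ne _ (left_ne_zero_of_mul hy)

end Summit.QuantumFields.YangMills.Theorems
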